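import Literature.NumberTheory.Automorphic.WeightForms
import Mathlib.LinearAlgebra.Matrix.ToLin
import Mathlib.Topology.Instances.Matrix
import HarnessLib

/-!
# Automorphy factors: forms on a homogeneous space versus weight forms on the group

Topic `NumberTheory/Automorphic`; namespace `Literature.NumberTheory.Automorphic.AutomorphyFactor`.
The classical dictionary between functions on a `G`-space `X` that are automorphic for a factor
of automorphy and functions on the group `G` of a given `K`-type, `K` the stabiliser of a base
point:
[Borel1997] Lemma 5.13 (`f̃(x) = f(x.i) μ(x,i)^{-m}` is of right `K`-type `m`, and
`(x⁻¹ ∘ f)˜ = l_x f̃` for the action `(x ∘ f)(z) = f(x.z) μ(x,z)^{-m}`), §5.14 (classical forms of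
weight `m` ↦ automorphic forms on `G`) and §5.18 (the Petersson product becomes the scalar product
on `Γ \ G`) — there for `SL₂(ℝ)` and the scalar factor `μ(g,z)^{-m}`; here for any action and any
`End(V)`-valued factor (vector-valued forms, e.g. holomorphic `1`-forms on a ball quotient).

We use the PULL-BACK convention of differential forms: a *pull-back cocycle* is a map
`A : G → X → Module.End R V` with `A 1 x = 1` and the chain rule
`A (g * h) x = A h x * A g (h • x)` — e.g. `A γ x = ᵗ(dγ)_x` acting on the fibre `V = T*_x` of a
trivialised cotangent bundle, so that `(γ^* u)(x) = A γ x (u (γ • x))` for a section `u : X → V`.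

* `factorForms Γ A = {F : X → V | ∀ γ ∈ Γ, F x = A γ x (F (γ • x))}`: the `Γ`-invariant sections
  (`γ^* F = F`);
* `weightOf hA o : Representation R (stabilizer G o) V`, `k ↦ A k⁻¹ o` — the isotropy
  representation at the base point `o`;
* `toGroup hA o : factorForms Γ A →ₗ[R] weightForms Γ (stabilizer G o).subtype (weightOf hA o)`,
  `F ↦ (g ↦ A g o (F (g • o)))` — LEFT `Γ`-invariant, of RIGHT `K`-type `weightOf` in the sense of
  `WeightForms` (`f (g k) = τ(k)⁻¹ f g`); injective when `G` is transitive on `X`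
  (`toGroup_injective`);
* `ofGroup hA hs : weightForms … →ₗ[R] factorForms Γ A` for a section `s : X → G` of the orbit map
  (`s x • o = x`), `f ↦ (x ↦ A (s x)⁻¹ x (f (s x)))`, and the linear equivalence
  `factorFormsEquiv hA hs :
    factorForms Γ A ≃ₗ[R] weightForms Γ (stabilizer G o).subtype (weightOf hA o)`
  (no choice: the inverse is explicit in the section);
* matrix-valued factors `J : G → X → Matrix n n R` (`matrixCocycle`, `F x = J γ x *ᵥ F (γ • x)`),
  scalar factors `j : G → X → R` (`scalarCocycle`, `F x = j γ x • F (γ • x)`; e.g. `j = det J` for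
  top-degree forms, `scalarCocycle_det`), and continuity of `toGroup F` (`continuous_toGroup`).

Everything here is elementary algebra and is proved.
-/

namespace Literature.NumberTheory.Automorphic

namespace AutomorphyFactor

open MulAction Matrix

variable {G X : Type*} [Group G] [MulAction G X]
variable {R V : Type*} [CommRing R] [AddCommGroup V] [Module R V]

/-! ### Pull-back cocycles -/

/-- A **pull-back cocycle** (factor of automorphy in the pull-back convention): `A 1 x = 1` and the
chain rule `A (g h) x = A h x ∘ A g (h x)`. [folklore] -/
structure IsPullbackCocycle (A : G → X → Module.End R V) : Prop where
  /-- `A 1 = 1`. -/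
  map_one : ∀ x, A 1 x = 1
  /-- The chain rule. -/
  map_mul : ∀ g h x, A (g * h) x = A h x * A g (h • x)

namespace IsPullbackCocycle

variable {A : G → X → Module.End R V} (hA : IsPullbackCocycle A)
include hA

/-- `A g x ∘ A g⁻¹ (g x) = 1`. [folklore] -/
theorem mul_inv_smul (g : G) (x : X) : A g x * A g⁻¹ (g • x) = 1 := by
  rw [← hA.map_mul, inv_mul_cancel, hA.map_one]

/-- `A g⁻¹ (g x) ∘ A g x = 1`. [folklore] -/
theorem inv_smul_mul (g : G) (x : X) : A g⁻¹ (g • x) * A g x = 1 := by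
  have h := hA.map_mul g g⁻¹ (g • x)
  rwa [mul_inv_cancel, hA.map_one, smul_smul, inv_mul_cancel, one_smul, eq_comm] at h

/-- `A g x (A g⁻¹ (g x) v) = v`. [folklore] -/
@[simp] theorem apply_inv_apply (g : G) (x : X) (v : V) : A g x (A g⁻¹ (g • x) v) = v := by
  rw [← Module.End.mul_apply, hA.mul_inv_smul, Module.End.one_apply]

/-- `A g⁻¹ (g x) (A g x v) = v`. [folklore] -/
@[simp] theorem inv_apply_apply (g : G) (x : X) (v : V) : A g⁻¹ (g • x) (A g x v) = v := by
  rw [← Module.End.mul_apply, hA.inv_smul_mul, Module.End.one_apply]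

/-- Each `A g x` is invertible. [folklore] -/
theorem isUnit (g : G) (x : X) : IsUnit (A g x) :=
  isUnit_iff_exists.mpr ⟨A g⁻¹ (g • x), hA.mul_inv_smul g x, hA.inv_smul_mul g x⟩

/-- At a point fixed by `k`, `A k⁻¹ x ∘ A k x = 1`. [folklore] -/
theorem inv_mul_of_smul_eq {k : G} {x : X} (h : k • x = x) : A k⁻¹ x * A k x = 1 := by
  simpa only [h] using hA.inv_smul_mul k x

/-- At a point fixed by `k`, `A k x ∘ A k⁻¹ x = 1`. [folklore] -/
theorem mul_inv_of_smul_eq {k : G} {x : X} (h : k • x = x) : A k x * A k⁻¹ x = 1 := by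
  simpa only [h] using hA.mul_inv_smul k x

/-- **The isotropy representation** of the cocycle at a base point `o`: `k ↦ A k⁻¹ o` on the
stabiliser `K = Stab_G(o)` (a homomorphism by the chain rule). [folklore] -/
def weightOf (o : X) : Representation R (stabilizer G o) V where
  toFun k := A ((k : G)⁻¹) o
  map_one' := by simp [hA.map_one]
  map_mul' k₁ k₂ := by
    have h₁ : (k₁ : G)⁻¹ • o = o := by
      rw [← mem_stabilizer_iff]; exact inv_mem k₁.2
    simp only [Subgroup.coe_mul, _root_.mul_inv_rev, hA.map_mul, h₁]

/-- `weightOf hA o k = A k⁻¹ o`. [folklore] -/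
@[simp] theorem weightOf_apply (o : X) (k : stabilizer G o) :
    hA.weightOf o k = A ((k : G)⁻¹) o := rfl

/-- `weightOf hA o k⁻¹ = A k o`. [folklore] -/
theorem weightOf_inv_apply (o : X) (k : stabilizer G o) :
    hA.weightOf o k⁻¹ = A (k : G) o := by
  simp

end IsPullbackCocycle

/-! ### `Γ`-invariant sections -/

/-- **Forms of automorphy factor `A` for `Γ`**: sections `F : X → V` with `γ^* F = F`, i.e.
`F x = A γ x (F (γ • x))` for `γ ∈ Γ`. [folklore] -/
def factorForms (Γ : Subgroup G) (A : G → X → Module.End R V) : Submodule R (X → V) where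
  carrier := {F | ∀ γ ∈ Γ, ∀ x, F x = A γ x (F (γ • x))}
  add_mem' {F F'} hF hF' γ hγ x := by simp only [Pi.add_apply, map_add, ← hF γ hγ x, ← hF' γ hγ x]
  zero_mem' γ hγ x := by simp
  smul_mem' c F hF γ hγ x := by simp only [Pi.smul_apply, map_smul, ← hF γ hγ x]

variable {Γ : Subgroup G} {A : G → X → Module.End R V}

/-- Membership in `factorForms`. [folklore] -/
theorem mem_factorForms_iff {F : X → V} :
    F ∈ factorForms Γ A ↔ ∀ γ ∈ Γ, ∀ x, F x = A γ x (F (γ • x)) := Iff.rfl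

/-- `factorForms` is antitone in `Γ`. [folklore] -/
theorem factorForms_anti {Γ' : Subgroup G} (h : Γ' ≤ Γ) : factorForms Γ A ≤ factorForms Γ' A :=
  fun _ hF γ hγ x ↦ hF γ (h hγ) x

/-- The pull-back form of invariance: `F (γ • x) = A γ⁻¹ (γ • x) (F x)`. [folklore] -/
theorem apply_smul_of_mem (hA : IsPullbackCocycle A) {F : X → V} (hF : F ∈ factorForms Γ A) {γ : G}
    (hγ : γ ∈ Γ) (x : X) : F (γ • x) = A γ⁻¹ (γ • x) (F x) := by
  rw [hF γ hγ x, hA.inv_apply_apply]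

/-! ### From forms on `X` to weight forms on `G` -/

section ToGroup

variable (A) in
/-- The function on the group attached to a section and a base point: `g ↦ A g o (F (g • o))`.
[folklore] -/
def toGroupFun (o : X) (F : X → V) : G → V := fun g ↦ A g o (F (g • o))

/-- `toGroupFun A o F g = A g o (F (g • o))`. [folklore] -/
@[simp] theorem toGroupFun_apply (o : X) (F : X → V) (g : G) :
    toGroupFun A o F g = A g o (F (g • o)) := rfl

/-- **The group function of an invariant section is a weight form**: left `Γ`-invariant and of right
`K`-type `weightOf` (`f (g k) = A k o (f g) = τ(k⁻¹) f g`). [folklore] -/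
theorem toGroupFun_mem (hA : IsPullbackCocycle A) (o : X) {F : X → V} (hF : F ∈ factorForms Γ A) :
    toGroupFun A o F ∈ weightForms Γ (stabilizer G o).subtype (hA.weightOf o) := by
  refine WeightForms.mem_iff.mpr ⟨fun γ hγ g ↦ ?_, fun k g ↦ ?_⟩
  · rw [toGroupFun_apply, toGroupFun_apply, hA.map_mul, Module.End.mul_apply, mul_smul,
      ← hF γ hγ (g • o)]
  · have hk : (k : G) • o = o := mem_stabilizer_iff.mp k.2
    rw [toGroupFun_apply, toGroupFun_apply, Subgroup.coe_subtype, hA.map_mul,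
      Module.End.mul_apply, mul_smul, hk, hA.weightOf_inv_apply]

/-- **`toGroup`**: `factorForms Γ A →ₗ weightForms Γ K (weightOf)`, `F ↦ (g ↦ A g o (F (g • o)))`.
[folklore] -/
def toGroup (hA : IsPullbackCocycle A) (o : X) :
    factorForms Γ A →ₗ[R] weightForms Γ (stabilizer G o).subtype (hA.weightOf o) where
  toFun F := ⟨toGroupFun A o F, toGroupFun_mem hA o F.2⟩
  map_add' F F' := by ext g; simp
  map_smul' c F := by ext g; simp

/-- `toGroup F g = A g o (F (g • o))`. [folklore] -/
@[simp] theorem toGroup_apply (hA : IsPullbackCocycle A) (o : X) (F : factorForms Γ A) (g : G) :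
    (toGroup hA o F : G → V) g = A g o ((F : X → V) (g • o)) := rfl

/-- For a transitive action, a section is determined by its group function. [folklore] -/
theorem toGroup_injective (hA : IsPullbackCocycle A) (o : X) [IsPretransitive G X] :
    Function.Injective (toGroup (Γ := Γ) hA o) := by
  intro F F' h
  ext x
  obtain ⟨g, rfl⟩ := exists_smul_eq G o x
  have hg := congrArg (fun f : weightForms Γ (stabilizer G o).subtype (hA.weightOf o) ↦
    A g⁻¹ (g • o) ((f : G → V) g)) h
  simpa only [toGroup_apply, hA.inv_apply_apply] using hg

end ToGroup

/-! ### From weight forms on `G` back to forms on `X`, along a section of the orbit map -/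

section OfGroup

variable {o : X} {s : X → G}

/-- Two group elements with the same effect on `o` differ by the stabiliser on the right.
[folklore] -/
theorem exists_eq_mul_of_smul_eq {g g' : G} (h : g' • o = g • o) :
    ∃ k ∈ stabilizer G o, g' = g * k :=
  ⟨g⁻¹ * g', by rw [mem_stabilizer_iff, mul_smul, h, smul_smul, inv_mul_cancel, one_smul],
    by rw [mul_inv_cancel_left]⟩

variable (A) in
/-- The section on `X` attached to a group function and a section `s` of `g ↦ g • o`:
`x ↦ A (s x)⁻¹ x (f (s x))` (`A (s x)⁻¹ x` is the inverse of `A (s x) o`). [folklore] -/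
def ofGroupFun (s : X → G) (f : G → V) : X → V := fun x ↦ A (s x)⁻¹ x (f (s x))

omit [MulAction G X] in
/-- `ofGroupFun A s f x = A (s x)⁻¹ x (f (s x))`. [folklore] -/
@[simp] theorem ofGroupFun_apply (s : X → G) (f : G → V) (x : X) :
    ofGroupFun A s f x = A (s x)⁻¹ x (f (s x)) := rfl

/-- Key computation: a weight form evaluated through ANY `g` with `g • o = x` gives the value of
`ofGroupFun` at `x`. [folklore] -/
theorem ofGroupFun_eq (hA : IsPullbackCocycle A) (hs : ∀ x, s x • o = x) {f : G → V}
    (hf : f ∈ weightForms Γ (stabilizer G o).subtype (hA.weightOf o)) {g : G} {x : X}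
    (hg : g • o = x) : ofGroupFun A s f x = A g⁻¹ x (f g) := by
  obtain ⟨k, hk, hsk⟩ := exists_eq_mul_of_smul_eq (o := o) (g := g) (g' := s x) (by rw [hs, hg])
  have hko : k • o = o := mem_stabilizer_iff.mp hk
  have hgo : g⁻¹ • x = o := by rw [inv_smul_eq_iff, hg]
  have hright : f (g * k) = A k o (f g) := by
    simpa only [Subgroup.coe_subtype, hA.weightOf_inv_apply] using
      (WeightForms.mem_iff.mp hf).2 ⟨k, hk⟩ g
  have hkk : A k⁻¹ o (A k o (f g)) = f g := by
    have h := hA.inv_apply_apply k o (f g)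
    rwa [hko] at h
  rw [ofGroupFun_apply, hsk, hright, _root_.mul_inv_rev, hA.map_mul, Module.End.mul_apply, hgo, hkk]

/-- **The section of a weight form is `Γ`-invariant.** [folklore] -/
theorem ofGroupFun_mem (hA : IsPullbackCocycle A) (hs : ∀ x, s x • o = x) {f : G → V}
    (hf : f ∈ weightForms Γ (stabilizer G o).subtype (hA.weightOf o)) :
    ofGroupFun A s f ∈ factorForms Γ A := by
  intro γ hγ x
  have hleft : f (γ * s x) = f (s x) := (WeightForms.mem_iff.mp hf).1 γ hγ (s x)
  rw [ofGroupFun_eq hA hs hf (g := γ * s x) (x := γ • x) (by rw [mul_smul, hs]), hleft,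
    _root_.mul_inv_rev, hA.map_mul, Module.End.mul_apply, inv_smul_smul, hA.apply_inv_apply,
    ofGroupFun_apply]

/-- **`ofGroup`**: `weightForms Γ K (weightOf) →ₗ factorForms Γ A` along a section `s`.
[folklore] -/
def ofGroup (hA : IsPullbackCocycle A) (hs : ∀ x, s x • o = x) :
    weightForms Γ (stabilizer G o).subtype (hA.weightOf o) →ₗ[R] factorForms Γ A where
  toFun f := ⟨ofGroupFun A s f, ofGroupFun_mem hA hs f.2⟩
  map_add' f f' := by ext x; simp
  map_smul' c f := by ext x; simp

/-- `ofGroup f x = A (s x)⁻¹ x (f (s x))`. [folklore] -/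
@[simp] theorem ofGroup_apply (hA : IsPullbackCocycle A) (hs : ∀ x, s x • o = x)
    (f : weightForms Γ (stabilizer G o).subtype (hA.weightOf o)) (x : X) :
    (ofGroup hA hs f : X → V) x = A (s x)⁻¹ x ((f : G → V) (s x)) := rfl

/-- `ofGroup (toGroup F) = F`. [folklore] -/
theorem ofGroup_toGroup (hA : IsPullbackCocycle A) (hs : ∀ x, s x • o = x) (F : factorForms Γ A) :
    ofGroup hA hs (toGroup hA o F) = F := by
  ext x
  have h := hA.inv_apply_apply (s x) o ((F : X → V) (s x • o))
  rw [hs x] at h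
  rw [ofGroup_apply, toGroup_apply, hs x, h]

/-- `toGroup (ofGroup f) = f`. [folklore] -/
theorem toGroup_ofGroup (hA : IsPullbackCocycle A) (hs : ∀ x, s x • o = x)
    (f : weightForms Γ (stabilizer G o).subtype (hA.weightOf o)) :
    toGroup hA o (ofGroup hA hs f) = f := by
  ext g
  have h := ofGroupFun_eq hA hs f.2 (g := g) rfl
  rw [ofGroupFun_apply] at h
  rw [toGroup_apply, ofGroup_apply, h, hA.apply_inv_apply]

/-- **The dictionary**: forms of automorphy factor `A` for `Γ` on `X` ≃ weight forms on `G`, left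
`Γ`-invariant of right `K`-type `weightOf` (`K` the stabiliser of `o`, `s` any section of
`g ↦ g • o`). [folklore] -/
def factorFormsEquiv (hA : IsPullbackCocycle A) (hs : ∀ x, s x • o = x) :
    factorForms Γ A ≃ₗ[R] weightForms Γ (stabilizer G o).subtype (hA.weightOf o) :=
  LinearEquiv.ofLinear (toGroup hA o) (ofGroup hA hs)
    (LinearMap.ext (toGroup_ofGroup hA hs)) (LinearMap.ext (ofGroup_toGroup hA hs))

/-- `factorFormsEquiv F = toGroup F`. [folklore] -/
@[simp] theorem factorFormsEquiv_apply (hA : IsPullbackCocycle A) (hs : ∀ x, s x • o = x)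
    (F : factorForms Γ A) : factorFormsEquiv hA hs F = toGroup hA o F := rfl

/-- `factorFormsEquiv.symm f = ofGroup f`. [folklore] -/
@[simp] theorem factorFormsEquiv_symm_apply (hA : IsPullbackCocycle A) (hs : ∀ x, s x • o = x)
    (f : weightForms Γ (stabilizer G o).subtype (hA.weightOf o)) :
    (factorFormsEquiv hA hs).symm f = ofGroup hA hs f := rfl

end OfGroup

/-! ### Matrix-valued and scalar factors of automorphy -/

section MatrixCocycle

variable {n : Type*} [Fintype n] [DecidableEq n]

/-- The `Module.End`-valued cocycle of a matrix factor `J : G → X → Matrix n n R`. [folklore] -/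
def matrixCocycle (J : G → X → Matrix n n R) : G → X → Module.End R (n → R) :=
  fun g x ↦ Matrix.toLin' (J g x)

omit [Group G] [MulAction G X] in
/-- `matrixCocycle J g x v = J g x *ᵥ v`. [folklore] -/
@[simp] theorem matrixCocycle_apply (J : G → X → Matrix n n R) (g : G) (x : X) (v : n → R) :
    matrixCocycle J g x v = J g x *ᵥ v := Matrix.toLin'_apply _ _

/-- A matrix factor with `J 1 x = 1` and the chain rule `J (g h) x = J h x * J g (h x)` (e.g. the
TRANSPOSED Jacobian `ᵗ(d g)_x` of a smooth action) gives a pull-back cocycle. [folklore] -/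
theorem isPullbackCocycle_matrixCocycle {J : G → X → Matrix n n R} (h1 : ∀ x, J 1 x = 1)
    (hmul : ∀ g h x, J (g * h) x = J h x * J g (h • x)) : IsPullbackCocycle (matrixCocycle J) where
  map_one x := by rw [matrixCocycle, h1, Matrix.toLin'_one]; rfl
  map_mul g h x := by rw [matrixCocycle, matrixCocycle, matrixCocycle, hmul, Matrix.toLin'_mul,
    Module.End.mul_eq_comp]

/-- Membership in `factorForms` for a matrix factor: `F x = J γ x *ᵥ F (γ • x)`. [folklore] -/
theorem mem_factorForms_matrixCocycle_iff {J : G → X → Matrix n n R} {F : X → n → R} :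
    F ∈ factorForms Γ (matrixCocycle J) ↔ ∀ γ ∈ Γ, ∀ x, F x = J γ x *ᵥ F (γ • x) := by
  simp only [mem_factorForms_iff, matrixCocycle_apply]

/-- **Continuity of the group function**: if `g ↦ J g o` and `F` are continuous and the action is
continuous, `g ↦ J g o *ᵥ F (g • o)` is continuous. [folklore] -/
theorem continuous_toGroupFun_matrixCocycle [TopologicalSpace G] [TopologicalSpace X]
    [TopologicalSpace R] [IsTopologicalRing R] [ContinuousSMul G X] {J : G → X → Matrix n n R}
    {o : X} (hJ : Continuous fun g ↦ J g o) {F : X → n → R} (hF : Continuous F) :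
    Continuous (toGroupFun (matrixCocycle J) o F) := by
  have h : toGroupFun (matrixCocycle J) o F = fun g ↦ J g o *ᵥ F (g • o) := by
    ext g; simp
  rw [h]
  exact hJ.matrix_mulVec (hF.comp (continuous_id.smul continuous_const))

end MatrixCocycle

section ScalarCocycle

/-- The `Module.End`-valued cocycle of a scalar factor `j : G → X → R` acting by homotheties.
[folklore] -/
def scalarCocycle (V : Type*) [AddCommGroup V] [Module R V] (j : G → X → R) :
    G → X → Module.End R V :=
  fun g x ↦ j g x • (1 : Module.End R V)

omit [Group G] [MulAction G X] in
/-- `scalarCocycle V j g x v = j g x • v`. [folklore] -/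
@[simp] theorem scalarCocycle_apply (j : G → X → R) (g : G) (x : X) (v : V) :
    scalarCocycle V j g x v = j g x • v := rfl

/-- A scalar factor with `j 1 x = 1` and `j (g h) x = j h x * j g (h x)` gives a pull-back cocycle.
[folklore] -/
theorem isPullbackCocycle_scalarCocycle {j : G → X → R} (h1 : ∀ x, j 1 x = 1)
    (hmul : ∀ g h x, j (g * h) x = j h x * j g (h • x)) :
    IsPullbackCocycle (scalarCocycle V j) where
  map_one x := by simp [scalarCocycle, h1]
  map_mul g h x := by
    ext v
    simp only [scalarCocycle_apply, hmul, Module.End.mul_apply, map_smul, smul_smul, mul_comm]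

/-- Membership in `factorForms` for a scalar factor: `F x = j γ x • F (γ • x)`. [folklore] -/
theorem mem_factorForms_scalarCocycle_iff {j : G → X → R} {F : X → V} :
    F ∈ factorForms Γ (scalarCocycle V j) ↔ ∀ γ ∈ Γ, ∀ x, F x = j γ x • F (γ • x) := by
  simp only [mem_factorForms_iff, scalarCocycle_apply]

variable {n : Type*} [Fintype n] [DecidableEq n]

/-- **The determinant of a matrix cocycle is a scalar cocycle** (the factor of top-degree forms:
`γ^*(F dx₁ ∧ … ∧ dxₙ) = det(ᵗdγ) · (F ∘ γ) dx₁ ∧ … ∧ dxₙ`). [folklore] -/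
theorem isPullbackCocycle_scalarCocycle_det {J : G → X → Matrix n n R} (h1 : ∀ x, J 1 x = 1)
    (hmul : ∀ g h x, J (g * h) x = J h x * J g (h • x)) :
    IsPullbackCocycle (scalarCocycle V fun g x ↦ (J g x).det) :=
  isPullbackCocycle_scalarCocycle (fun x ↦ by simp [h1]) fun g h x ↦ by rw [hmul, Matrix.det_mul]

/-- Continuity of the group function for a scalar factor. [folklore] -/
theorem continuous_toGroupFun_scalarCocycle [TopologicalSpace G] [TopologicalSpace X]
    [TopologicalSpace R] [TopologicalSpace V] [ContinuousSMul R V] [ContinuousSMul G X]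
    {j : G → X → R} {o : X} (hj : Continuous fun g ↦ j g o) {F : X → V} (hF : Continuous F) :
    Continuous (toGroupFun (scalarCocycle V j) o F) := by
  have h : toGroupFun (scalarCocycle V j) o F = fun g ↦ j g o • F (g • o) := by
    ext g; simp
  rw [h]
  exact hj.smul (hF.comp (continuous_id.smul continuous_const))

end ScalarCocycle

end AutomorphyFactor

end Literature.NumberTheory.Automorphic
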